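import Summits.AtomisticToContinuum.Crystallization.Theorems.FrustratedLawDichotomyStrainedPatchHomEntryRecord
import Summits.AtomisticToContinuum.Crystallization.Theorems.FrustratedLawDichotomyStrainedPatchHomEntryFitCart

/-!
# The fcc entry-leaf verdict OF RECORD for the census (single name): Cartesian sharp fit ∨ record verdict; `(H) HomFloor (1/625)` from two Booleans

decomp-a2c hand-2 g22 (crux `AperiodicFrustratedLawGap`, stmt-AtomisticToContinuum-27623).  One definition combining every sound fcc entry-leaf verdict in
the tree — `fitOK3` (Cartesian sharp fit, `…HomEntryFitCart`) ∨ `entryLeafOKR μ` (`fitOK2` ∨ hand-1's `fitOK ∨ asymOK ∨ colOutOK ∨ tableLeafOK μ`,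
`…HomEntryRecord`) — so that census H-FCC-COUNT has a single acceptance test, and the (H) assembly with it:
★★★ `homFloor_625_of_bestTrees : treeOK (entryLeafOKB muRec) tF rootC rootW = true → treeOK (entryLeafOKH2 muRec) tH rootCH rootWH = true → HomFloor (1/625)`.
One definition; 0 sorry; standard axioms; no instances / notation.  `--supports stmt-AtomisticToContinuum-27623`.
-/

namespace Summit.AtomisticToContinuum.Crystallization.Theorems.FrustratedLawDichotomyStrainedPatchHomEntryBest

open scoped BigOperators RealInnerProductSpace
open Literature.Analysis.ValidatedNumerics.Numerics
open Summit.AtomisticToContinuum.Crystallization.Theorems.ChargedEnergyGapNegative (E3)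
open Summit.AtomisticToContinuum.Crystallization.Theorems.FrustratedLawDichotomySchurCut (effPot w₄₅ ω₄)
open Summit.AtomisticToContinuum.Crystallization.Theorems.FrustratedLawDichotomyAveragingRuleTightFree (TightNearCap BadNearCap)
open Summit.AtomisticToContinuum.Crystallization.Theorems.FrustratedLawDichotomyExemptAbsorption (ExemptNear)
open Summit.AtomisticToContinuum.Crystallization.Theorems.FrustratedLawDichotomyStrainedPatchHomSplit
open Summit.AtomisticToContinuum.Crystallization.Theorems.FrustratedLawDichotomyStrainedPatchHomPrunedPolar (homFloor_of_prunedBoxSums_selfAdjoint)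
open Summit.AtomisticToContinuum.Crystallization.Theorems.FrustratedLawDichotomyStrainedPatchHomCertTree (CertTree treeOK)
open Summit.AtomisticToContinuum.Crystallization.Theorems.FrustratedLawDichotomyStrainedPatchHomEntryGram
open Summit.AtomisticToContinuum.Crystallization.Theorems.FrustratedLawDichotomyStrainedPatchHomEntryFitCart (fitOK3 fitOK3_sound)
open Summit.AtomisticToContinuum.Crystallization.Theorems.FrustratedLawDichotomyStrainedPatchHomEntryRecord (entryLeafOKR entryLeafOKR_sound)
open Summit.AtomisticToContinuum.Crystallization.Theorems.FrustratedLawDichotomyStrainedPatchHomEntryGramHcp (rootCH rootWH)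
open Summit.AtomisticToContinuum.Crystallization.Theorems.FrustratedLawDichotomyStrainedPatchHomEntryFitHcp (entryLeafOKH2 hcpHalf_of_entryFitTree)
open Summit.AtomisticToContinuum.Crystallization.Theorems.FrustratedLawDichotomyStrainedPatchHomEntryTable (muRec muRec_ok)
open Literature.Barriers.AtomisticToContinuum.FlatleyTheil2015 (fccVec)

/-- ★ **fcc ENTRY-LEAF VERDICT OF RECORD**: `fitOK3 ∨ entryLeafOKR μ` (= Cartesian sharp fit ∨ sharp fit ∨ fit ∨ symmetry ∨ column ∨ table-(P4)). -/
def entryLeafOKB (μ : ℤ) (c w : Fin 3 × Fin 3 → ℤ) : Bool := fitOK3 c w || entryLeafOKR μ c w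

/-- ★ Soundness of `entryLeafOKB` (shape of `…HomEntryGram.fccHalf_of_entryTree`). [folklore] -/
theorem entryLeafOKB_sound {μ : ℤ} {c w : Fin 3 × Fin 3 → ℤ} (h : entryLeafOKB μ c w = true) (U : E3 →L[ℝ] E3)
    (hsa : ∀ v v' : E3, ⟪U v, v'⟫ = ⟪v, U v'⟫) (hU : ‖U - 1‖ ≤ 1 / 4)
    (hbox : ∀ ab : Fin 3 × Fin 3, |(U (EuclideanSpace.single ab.2 (1 : ℝ))) ab.1 - (c ab : ℝ) / SC| ≤ (w ab : ℝ) / SC) :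
    (∀ (M : ℕ) (z : Fin M → E3) (c : Fin M), Function.Injective z →
        Set.range z = {x : E3 | dist x (z c) ≤ 133 / 10 ∧ ∃ a : Fin 3 → ℤ, x = z c + latPt U fccVec a} →
        TightNearCap (9 / 5) (3 / 2) z c ∨ ExemptNear (9 / 5) ExRec z c ∨ BadNearCap (9 / 5) (3 / 2) z c) ∨
      (μ : ℝ) / SC ≤ ∑ b ∈ (Fintype.piFinset fun _ : Fin 3 => Finset.Icc (-7 : ℤ) 7).filter (fun b => b ≠ 0),
        effPot w₄₅ ω₄ (3 / 400) ‖latPt U fccVec b‖ := by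
  simp only [entryLeafOKB, Bool.or_eq_true] at h
  rcases h with h | h
  · exact Or.inl (fitOK3_sound h U hU hbox)
  · exact entryLeafOKR_sound h U hsa hU hbox

/-- ★★ The fcc half from ONE Boolean with the verdict of record. [folklore] -/
theorem fccHalf_of_entryBestTree {m : ℝ} {μ : ℤ} (hμ : 2 * (m + (-(7175 / 10000) + 3 / 400)) * SC ≤ μ)
    {t : CertTree (Fin 3 × Fin 3)} (h : treeOK (entryLeafOKB μ) t rootC rootW = true) :
    ∀ U : E3 →L[ℝ] E3, (∀ v w : E3, inner ℝ (U v) w = inner ℝ v (U w)) → (∀ w : E3, 0 ≤ inner ℝ w (U w)) → ‖U - 1‖ ≤ 1 / 4 →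
      (∀ (M : ℕ) (z : Fin M → E3) (c : Fin M), Function.Injective z →
          Set.range z = {x : E3 | dist x (z c) ≤ 133 / 10 ∧ ∃ a : Fin 3 → ℤ, x = z c + latPt U fccVec a} →
          TightNearCap (9 / 5) (3 / 2) z c ∨ ExemptNear (9 / 5) ExRec z c ∨ BadNearCap (9 / 5) (3 / 2) z c) ∨
      m ≤ (∑ b ∈ (Fintype.piFinset fun _ : Fin 3 => Finset.Icc (-7 : ℤ) 7).filter (fun b => b ≠ 0),
        effPot w₄₅ ω₄ (3 / 400) ‖latPt U fccVec b‖) / 2 - (-(7175 / 10000) + 3 / 400) :=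
  fccHalf_of_entryTree hμ (entryLeafOKB μ) (fun _ _ hv U hsa hU hbox => entryLeafOKB_sound hv U hsa hU hbox) h

/-- ★★★ **`(H) HomFloor (1/625)` FROM THE TWO BOOLEANS OF RECORD.** [folklore] -/
theorem homFloor_625_of_bestTrees {tF : CertTree (Fin 3 × Fin 3)} (hF : treeOK (entryLeafOKB muRec) tF rootC rootW = true)
    {tH : CertTree ((Fin 3 × Fin 3) ⊕ Fin 3)} (hH : treeOK (entryLeafOKH2 muRec) tH rootCH rootWH = true) : HomFloor (1 / 625) :=
  homFloor_of_prunedBoxSums_selfAdjoint (fccHalf_of_entryBestTree muRec_ok hF) (hcpHalf_of_entryFitTree muRec_ok hH)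

end Summit.AtomisticToContinuum.Crystallization.Theorems.FrustratedLawDichotomyStrainedPatchHomEntryBest
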